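import Mathlib
import Literature.Probability.Percolation.SmoothedWhiteNoise
import Summits.CriticalPhenomena.CardyFormulaZ2.Theorems.CardyWhiteToColouredDriftBoundStubSignLawSelfDual
import Summits.CriticalPhenomena.CardyFormulaZ2.Theorems.CardyWhiteToColouredDriftBoundStubSignLawPosAssoc

/-!
# Plackett/Piterbarg drift identity for the noise heat flow: the Gaussian weight family

Helper file for crux item `DriftBound` (stmt-CriticalPhenomena-4596) of route `CardyWhiteToColoured`
(`CardyFormulaZ2`), line `registered` (`Cruxes/DriftBound/Lines/birth.lean`, lead c3), sub-goal
`pl_gaussWeight_family` of the exact drift identity: the `σ`-derivative and a summable envelope of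
the Gaussian kernels of the smoothed lattice white noise
`X^σ(x) = ∑' e, q_σ(x − m_1 e) ξ_e` (`q_σ(z) = gaussWeight σ z = exp(−‖z‖²/(2σ²))`, `m_1 e` the
medial point of the edge `e` of `ℤ²`), as required by the generic drift identity
(`pl_hasDerivAt_integral_linGauss`, `pl_integral_fderiv_linGauss`) for the weight family
`G σ e = q_σ(x − m_1 e)` restricted to a compact range of widths `σ ∈ [a, b] ⊂ (0, ∞)`:

* the `σ`-derivative `d/dσ exp(−‖z‖²/(2σ²)) = (‖z‖²/σ³) exp(−‖z‖²/(2σ²))`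
  (`pw_hasDerivAt_gaussWeight`, chain rule);
* one summable envelope `u e = q_b(z_e) + (16 b²/a³) q_{2b}(z_e)` (`z_e = x − m_1 e`) dominating,
  uniformly for `σ ∈ [a, b]`, the kernel (monotonicity in the width, `pa_gaussWeight_mono`), its
  `σ`-derivative (`‖z‖² q_b(z) ≤ 8 b² q_{2b}(z)`, `pw_sq_mul_gaussWeight_le`, from `t ≤ eᵗ`) and the
  `σ`-derivative `2 q̇ q` of its square (`q ≤ 1`); summability of `q_ℓ(x − m_1 ·)` over the edges of
  `ℤ²` for every width `ℓ > 0` is `sd_summable_gaussWeight`.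

References: S. Muirhead, H. Vanneuville, Ann. Inst. H. Poincaré Probab. Stat. 56 (2020), §2.1
(discretised white noise, kernel `q`); D. Beliaev, S. Muirhead, A. Rivera, Ann. Probab. 48 (2020),
§2.2 (Piterbarg's formula: differentiating Gaussian functionals in a covariance parameter).
-/

noncomputable section

namespace Summit.CriticalPhenomena.CardyFormulaZ2.Cruxes.DriftBound.Birth

open Set
open Literature.Probability.LatticeModels Literature.Probability.Percolation
open Summit.CriticalPhenomena.CardyFormulaZ2.Theorems.WhiteToColoured

/-! ### The `σ`-derivative of the Gaussian kernel -/

/-- **`σ`-derivative of the Gaussian kernel**: for `σ > 0`,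
`d/ds|_{s=σ} exp(−‖z‖²/(2s²)) = (‖z‖²/σ³) exp(−‖z‖²/(2σ²))` (chain rule: the exponent
`s ↦ −‖z‖²/(2s²)` has derivative `‖z‖²/σ³` at `s = σ ≠ 0`). -/
theorem pw_hasDerivAt_gaussWeight {σ : ℝ} (hσ : 0 < σ) (z : ℂ) :
    HasDerivAt (fun s : ℝ => gaussWeight s z) (‖z‖ ^ 2 / σ ^ 3 * gaussWeight σ z) σ := by
  have hd : HasDerivAt (fun s : ℝ => -(‖z‖ ^ 2) / (2 * s ^ 2)) (‖z‖ ^ 2 / σ ^ 3) σ := by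
    have h : HasDerivAt (fun s : ℝ => -(‖z‖ ^ 2) / (2 * s ^ 2))
        ((0 * (2 * σ ^ 2) - -(‖z‖ ^ 2) * (2 * ((2 : ℕ) * σ ^ (2 - 1)))) / (2 * σ ^ 2) ^ 2) σ :=
      (hasDerivAt_const σ (-(‖z‖ ^ 2))).div ((hasDerivAt_pow 2 σ).const_mul 2) (by positivity)
    refine h.congr_deriv ?_
    norm_num
    field_simp
  have h := hd.exp
  rw [mul_comm] at h
  exact h

/-! ### The envelope of the `σ`-derivative -/

/-- **Gaussian absorption of the polynomial prefactor**: `‖z‖² q_b(z) ≤ 8 b² q_{2b}(z)` for `b > 0`,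
i.e. `t e^{−t/(2b²)} ≤ 8 b² e^{−t/(8b²)}` (`t = ‖z‖²`): from `t/(8b²) ≤ e^{t/(8b²)}` and
`e^{t/(8b²)} e^{−t/(2b²)} = e^{−3t/(8b²)} ≤ e^{−t/(8b²)}`. -/
theorem pw_sq_mul_gaussWeight_le {b : ℝ} (hb : 0 < b) (z : ℂ) :
    ‖z‖ ^ 2 * gaussWeight b z ≤ 8 * b ^ 2 * gaussWeight (2 * b) z := by
  unfold gaussWeight
  set t : ℝ := ‖z‖ ^ 2 with ht
  have ht0 : 0 ≤ t := sq_nonneg _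
  have hb2 : 0 < 8 * b ^ 2 := by positivity
  have h1 : t ≤ 8 * b ^ 2 * Real.exp (t / (8 * b ^ 2)) := by
    have h := Real.add_one_le_exp (t / (8 * b ^ 2))
    rw [mul_comm, ← div_le_iff₀ hb2]
    linarith
  have h2 : Real.exp (t / (8 * b ^ 2)) * Real.exp (-t / (2 * b ^ 2)) ≤
      Real.exp (-t / (2 * (2 * b) ^ 2)) := by
    rw [← Real.exp_add]
    refine Real.exp_le_exp.2 ?_
    have e1 : t / (8 * b ^ 2) + -t / (2 * b ^ 2) = -3 * (t / (8 * b ^ 2)) := by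
      field_simp
      ring
    have e2 : -t / (2 * (2 * b) ^ 2) = -(t / (8 * b ^ 2)) := by
      field_simp
      ring
    have h0 : 0 ≤ t / (8 * b ^ 2) := by positivity
    rw [e1, e2]
    linarith
  calc t * Real.exp (-t / (2 * b ^ 2))
      ≤ 8 * b ^ 2 * Real.exp (t / (8 * b ^ 2)) * Real.exp (-t / (2 * b ^ 2)) := by gcongr
    _ = 8 * b ^ 2 * (Real.exp (t / (8 * b ^ 2)) * Real.exp (-t / (2 * b ^ 2))) := by ring
    _ ≤ 8 * b ^ 2 * Real.exp (-t / (2 * (2 * b) ^ 2)) := by gcongr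

/-- **Uniform bound on the `σ`-derivative of the kernel on `[a, b]`**: for `0 < a ≤ σ ≤ b`,
`(‖z‖²/σ³) q_σ(z) ≤ (8 b²/a³) q_{2b}(z)` (`σ⁻³ ≤ a⁻³`, `q_σ ≤ q_b` by monotonicity in the width,
then `pw_sq_mul_gaussWeight_le`). -/
theorem pw_deriv_gaussWeight_le {a b σ : ℝ} (ha : 0 < a) (haσ : a ≤ σ) (hσb : σ ≤ b) (z : ℂ) :
    ‖z‖ ^ 2 / σ ^ 3 * gaussWeight σ z ≤ 8 * b ^ 2 / a ^ 3 * gaussWeight (2 * b) z := by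
  have hσ : 0 < σ := lt_of_lt_of_le ha haσ
  have hb : 0 < b := lt_of_lt_of_le hσ hσb
  have hwb : gaussWeight σ z ≤ gaussWeight b z := pa_gaussWeight_mono hσ hσb z
  have ha3 : 0 < a ^ 3 := by positivity
  have hσ3 : a ^ 3 ≤ σ ^ 3 := by gcongr
  calc ‖z‖ ^ 2 / σ ^ 3 * gaussWeight σ z
      ≤ ‖z‖ ^ 2 / a ^ 3 * gaussWeight b z :=
        mul_le_mul (div_le_div_of_nonneg_left (sq_nonneg _) ha3 hσ3) hwb (gaussWeight_pos σ z).le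
          (by positivity)
    _ = (a ^ 3)⁻¹ * (‖z‖ ^ 2 * gaussWeight b z) := by ring
    _ ≤ (a ^ 3)⁻¹ * (8 * b ^ 2 * gaussWeight (2 * b) z) :=
        mul_le_mul_of_nonneg_left (pw_sq_mul_gaussWeight_le hb z) (by positivity)
    _ = 8 * b ^ 2 / a ^ 3 * gaussWeight (2 * b) z := by ring

/-! ### The registered sub-goal -/

/-- **The Gaussian weight family of the smoothed lattice white noise (registered form).** For
`x ∈ ℂ` and widths `0 < a ≤ b`: (i) for every `σ > 0` and `z ∈ ℂ`, `s ↦ q_s(z)` has derivative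
`(‖z‖²/σ³) q_σ(z)` at `σ` (`pw_hasDerivAt_gaussWeight`); (ii) the envelope
`u e = q_b(z_e) + (16 b²/a³) q_{2b}(z_e)`, `z_e = x − m_1 e`, is summable over the edges of `ℤ²`
(`sd_summable_gaussWeight` at the widths `b` and `2b`) and dominates, for every `σ ∈ [a, b]` and
every edge `e`, the kernel `q_σ(z_e)` (`pa_gaussWeight_mono`), its `σ`-derivative
`(‖z_e‖²/σ³) q_σ(z_e)` (`pw_deriv_gaussWeight_le`) and the `σ`-derivative `2 q̇_σ(z_e) q_σ(z_e)` of
its square (`q_σ ≤ 1`). -/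
theorem pl_gaussWeight_family : ∀ (x : ℂ) (a b : ℝ), 0 < a → a ≤ b → (∀ σ : ℝ, 0 < σ → ∀ z : ℂ, HasDerivAt (fun s : ℝ => Literature.Probability.Percolation.gaussWeight s z) (‖z‖ ^ 2 / σ ^ 3 * Literature.Probability.Percolation.gaussWeight σ z) σ) ∧ ∃ u : (Literature.Probability.LatticeModels.zdGraph 2).edgeSet → ℝ, Summable u ∧ ∀ σ ∈ Set.Icc a b, ∀ e : (Literature.Probability.LatticeModels.zdGraph 2).edgeSet, |Literature.Probability.Percolation.gaussWeight σ (x - Literature.Probability.LatticeModels.medialPoint 1 e.1)| ≤ u e ∧ |‖x - Literature.Probability.LatticeModels.medialPoint 1 e.1‖ ^ 2 / σ ^ 3 * Literature.Probability.Percolation.gaussWeight σ (x - Literature.Probability.LatticeModels.medialPoint 1 e.1)| ≤ u e ∧ |2 * (‖x - Literature.Probability.LatticeModels.medialPoint 1 e.1‖ ^ 2 / σ ^ 3 * Literature.Probability.Percolation.gaussWeight σ (x - Literature.Probability.LatticeModels.medialPoint 1 e.1)) * Literature.Probability.Percolation.gaussWeight σ (x - Literature.Probability.LatticeModels.medialPoint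 1 e.1)| ≤ u e := by
  intro x a b ha hab
  have hb : 0 < b := lt_of_lt_of_le ha hab
  have h2b : 0 < 2 * b := by positivity
  refine ⟨fun σ hσ z => pw_hasDerivAt_gaussWeight hσ z, ?_⟩
  -- the envelope `u e = q_b(z_e) + K q_{2b}(z_e)`, `K = 16 b² / a³`
  set K : ℝ := 16 * b ^ 2 / a ^ 3 with hK
  have hK0 : 0 ≤ K := by positivity
  refine ⟨fun e => gaussWeight b (x - medialPoint 1 e.1) + K * gaussWeight (2 * b) (x - medialPoint 1 e.1),
    (sd_summable_gaussWeight hb x).add ((sd_summable_gaussWeight h2b x).mul_left K), ?_⟩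
  rintro σ ⟨haσ, hσb⟩ e
  -- abbreviate `z = z_e = x − m_1 e`
  set z : ℂ := x - medialPoint 1 e.1 with hz
  have hσ : 0 < σ := lt_of_lt_of_le ha haσ
  have hw0 : 0 < gaussWeight σ z := gaussWeight_pos σ z
  have hw1 : gaussWeight σ z ≤ 1 := gaussWeight_le_one σ z
  have hwb : gaussWeight σ z ≤ gaussWeight b z := pa_gaussWeight_mono hσ hσb z
  have hgb0 : 0 ≤ gaussWeight b z := (gaussWeight_pos b z).le
  have hg2b0 : 0 ≤ gaussWeight (2 * b) z := (gaussWeight_pos (2 * b) z).le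
  have hD0 : 0 ≤ ‖z‖ ^ 2 / σ ^ 3 * gaussWeight σ z := by positivity
  -- the `σ`-derivative is at most `(K/2) q_{2b}(z)`
  have hD : ‖z‖ ^ 2 / σ ^ 3 * gaussWeight σ z ≤ K / 2 * gaussWeight (2 * b) z := by
    have h := pw_deriv_gaussWeight_le ha haσ hσb z
    have e1 : K / 2 = 8 * b ^ 2 / a ^ 3 := by
      rw [hK]
      ring
    rwa [e1]
  have hKg : K / 2 * gaussWeight (2 * b) z ≤ K * gaussWeight (2 * b) z := by
    have h : 0 ≤ K / 2 * gaussWeight (2 * b) z := by positivity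
    linarith
  refine ⟨?_, ?_, ?_⟩
  · rw [abs_of_pos hw0]
    calc gaussWeight σ z ≤ gaussWeight b z := hwb
      _ ≤ gaussWeight b z + K * gaussWeight (2 * b) z := le_add_of_nonneg_right (by positivity)
  · rw [abs_of_nonneg hD0]
    calc ‖z‖ ^ 2 / σ ^ 3 * gaussWeight σ z ≤ K * gaussWeight (2 * b) z := hD.trans hKg
      _ ≤ gaussWeight b z + K * gaussWeight (2 * b) z := le_add_of_nonneg_left hgb0
  · rw [abs_of_nonneg (by positivity)]
    calc 2 * (‖z‖ ^ 2 / σ ^ 3 * gaussWeight σ z) * gaussWeight σ z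
        ≤ 2 * (‖z‖ ^ 2 / σ ^ 3 * gaussWeight σ z) * 1 := by gcongr
      _ ≤ 2 * (K / 2 * gaussWeight (2 * b) z) * 1 := by gcongr
      _ = K * gaussWeight (2 * b) z := by ring
      _ ≤ gaussWeight b z + K * gaussWeight (2 * b) z := le_add_of_nonneg_left hgb0

end Summit.CriticalPhenomena.CardyFormulaZ2.Cruxes.DriftBound.Birth

end
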